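import Literature.GroupTheory.PermutationGroups.Bochert
import Literature.GroupTheory.PermutationGroups.InvariantPartitionOrderBound
import HarnessLib

/-!
# Subgroups of small index in the symmetric group contain a large alternating group
# (Dixon–Mortimer, *Permutation Groups*, Theorem 5.2B)

Topic `Literature/GroupTheory/PermutationGroups`.  Fully PROVED (no named facts).

**Theorem** (Dixon–Mortimer 1996, Thm 5.2B, in the form printed and used by Dawar–Wilsenach,
*Symmetric circuits for rank logic*, ACM ToCL 23 (2021/22), §4, "Theorem [dixon1996permutation,
Theorem 5.2B]"): *Let `Y` be a set with `n := |Y| > 8`, and let `k` be an integer with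
`1 ≤ k ≤ n/4`. Suppose that `G ≤ Sym(Y)` has index `[Sym(Y) : G] < C(n, k)`. Then for some
`X ⊆ Y` with `|X| < k` we have `Stab_{Alt(Y)}(X) ≤ G`* (every EVEN permutation fixing `X`
pointwise lies in `G`): `alternating_fixing_le_of_index_lt_choose`.

## Proof (the classical one, assembled from the tree's permutation-group library)

1. (`card_lt_or_lt_of_invariant`) A `G`-invariant `d`-subset gives `C(n, d) ≤ [Sym : G]`
   (`choose_le_index_of_mapsTo`), so by unimodality of the binomials every invariant subset has
   fewer than `k` or more than `n - k` points.
2. (`card_smallPoints_lt`) Hence the union `X` of the orbits of size `< k` has `|X| < k`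
   (peel off one orbit at a time), and its complement `Ω'` (more than `n - k ≥ 3n/4` points) is a
   single orbit: `G` acts transitively on `Ω'`.
3. The kernel of `G → Sym(Ω')` embeds in `Sym(X)`, so `|G| ≤ |X|! · |H|` for the transitive
   group `H ≤ Sym(Ω')` induced on `Ω'` (`m := |Ω'| = n - |X|` points).
4. If `H` is imprimitive, a block system with `b ≥ 2` blocks of size `a ≥ 2` gives
   `|H| ≤ (a!)^b · b!` (`card_le_of_isBlock`), and `(a!)^b · b! ≤ 2 · ⌊m/2⌋! · ⌈m/2⌉!`
   (`factorial_pow_mul_factorial_le`, induction on `b`); if `H` is primitive but does not contain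
   `Alt(Ω')`, Bochert's theorem (`Bochert.card_le_descFactorial`) gives
   `|H| ≤ m (m-1) ⋯ (⌈m/2⌉ + 1)`.  In both cases `[Sym : G] ≥ C(n, k)` by elementary estimates
   (`two_mul_choose_le`, `choose_le_choose_mul_factorial_half`), a contradiction.
5. So `Alt(Ω') ≤ H`.  The elements of `G` fixing `X` pointwise induce a subgroup `L` of `H`
   normalised by `H`, of index `≤ |X|!` in… (precisely `|L| ≥ |G| / |X|! ≥ 3`); `L ∩ Alt(Ω')` is
   normal in the simple group `Alt(Ω')` (`m ≥ 5`, Mathlib's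
   `alternatingGroup.normal_subgroup_eq_bot_or_eq_top`), and is not trivial (else `|L| ≤ 2`), so
   `Alt(Ω') ≤ L`: every even permutation of `Y` fixing `X` pointwise is in `G`.

## References

* J. D. Dixon, B. Mortimer, *Permutation Groups*, GTM 163, Springer 1996, Theorem 5.2B
  (with Thm 5.2A = Bochert 1889 for the primitive case).
* A. Dawar, G. Wilsenach, *Symmetric circuits for rank logic*, ACM Trans. Comput. Logic 23(1)
  (2021/2022) [DawarWilsenach2021], §4 (statement as used here; arXiv:1804.02939 journal source,
  `sections/symmetry-and-support.tex`, Theorem `thm:dixonmort`).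
-/

namespace Literature.GroupTheory.PermutationGroups

open Equiv Equiv.Perm MulAction Subgroup

/-! ### Arithmetic -/

section Arithmetic

/-- Unimodality below the middle: `C(n, k) ≤ C(n, d)` for `k ≤ d ≤ n/2`. [folklore] -/
theorem choose_le_choose_of_le_half {n k d : ℕ} (hkd : k ≤ d) (hd : d ≤ n / 2) :
    n.choose k ≤ n.choose d := by
  induction d with
  | zero => simp [Nat.le_zero.1 hkd]
  | succ d ih =>
    rcases Nat.eq_or_lt_of_le hkd with rfl | hlt
    · exact le_rfl
    · exact (ih (Nat.lt_succ_iff.1 hlt) (by omega)).trans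
        (Nat.choose_le_succ_of_lt_half_left (by omega))

/-- Unimodality: `C(n, k) ≤ C(n, d)` whenever `k ≤ d ≤ n - k`. [folklore] -/
theorem choose_le_choose_of_le_of_le_sub {n k d : ℕ} (hkd : k ≤ d) (hd : d ≤ n - k) (hdn : d ≤ n) :
    n.choose k ≤ n.choose d := by
  by_cases h : d ≤ n / 2
  · exact choose_le_choose_of_le_half hkd h
  · rw [← Nat.choose_symm hdn]
    exact choose_le_choose_of_le_half (by omega) (by omega)

/-- `2 · C(n, k) ≤ C(n, k+1)` when `3k + 2 ≤ n`. [folklore] -/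
theorem two_mul_choose_le_choose_succ {n k : ℕ} (h : 3 * k + 2 ≤ n) : 2 * n.choose k ≤ n.choose (k + 1) := by
  have h1 : n.choose (k + 1) * (k + 1) = n.choose k * (n - k) := Nat.choose_succ_right_eq n k
  have h2 : 2 * (k + 1) ≤ n - k := by omega
  have h3 : 2 * n.choose k * (k + 1) ≤ n.choose (k + 1) * (k + 1) := by
    rw [h1]
    calc 2 * n.choose k * (k + 1) = n.choose k * (2 * (k + 1)) := by ring
      _ ≤ n.choose k * (n - k) := Nat.mul_le_mul_left _ h2
  exact Nat.le_of_mul_le_mul_right h3 (Nat.succ_pos k)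

/-- **`2 · C(n, k) ≤ C(n, ⌊n/2⌋)` for `4k ≤ n`** (room for a factor two below the middle binomial
coefficient). [folklore] -/
theorem two_mul_choose_le_choose_half {n k : ℕ} (h : 4 * k ≤ n) (hn : 5 ≤ n) :
    2 * n.choose k ≤ n.choose (n / 2) :=
  (two_mul_choose_le_choose_succ (by omega)).trans (Nat.choose_le_middle _ _)

/-- `C(n, j) · C(n - j, k) = C(n, k) · C(n - k, j)` (both count pairs of disjoint subsets). [folklore] -/
theorem choose_mul_choose_sub (n j k : ℕ) :
    n.choose j * (n - j).choose k = n.choose k * (n - k).choose j := by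
  have e1 : n.choose (j + k) * (j + k).choose j = n.choose j * (n - j).choose k := by
    have := Nat.choose_mul (n := n) (k := j + k) (s := j) (Nat.le_add_right j k)
    rw [Nat.add_sub_cancel_left] at this
    exact this
  have e2 : n.choose (j + k) * (j + k).choose k = n.choose k * (n - k).choose j := by
    have := Nat.choose_mul (n := n) (k := j + k) (s := k) (Nat.le_add_left k j)
    rw [Nat.add_sub_cancel] at this
    exact this
  rw [← e1, ← e2]
  rw [show (j + k).choose k = (j + k).choose j from by rw [add_comm, Nat.choose_symm_add]]

/-- **The imprimitive estimate**: `2 · C(n, k) ≤ C(n, j) · C(n - j, ⌊(n-j)/2⌋)` for `j < k`,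
`4k ≤ n`. [folklore] -/
theorem two_mul_choose_le {n k j : ℕ} (h : 4 * k ≤ n) (hn : 5 ≤ n) (hj : j < k) :
    2 * n.choose k ≤ n.choose j * (n - j).choose ((n - j) / 2) := by
  rcases Nat.eq_zero_or_pos j with rfl | hjpos
  · simpa using two_mul_choose_le_choose_half h hn
  · have h1 : (n - j).choose k ≤ (n - j).choose ((n - j) / 2) := Nat.choose_le_middle _ _
    have h2 : n.choose j * (n - j).choose k = n.choose k * (n - k).choose j :=
      choose_mul_choose_sub n j k
    have h3 : n - k ≤ (n - k).choose j := by
      rcases Nat.eq_or_lt_of_le hjpos with h1j | h1j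
      · rw [← h1j, Nat.choose_one_right]
      · calc n - k = (n - k).choose 1 := (Nat.choose_one_right _).symm
          _ ≤ (n - k).choose j := choose_le_choose_of_le_half (by omega) (by omega)
    have hnk : 2 ≤ n - k := by omega
    calc 2 * n.choose k = n.choose k * 2 := mul_comm _ _
      _ ≤ n.choose k * (n - k) := Nat.mul_le_mul_left _ hnk
      _ ≤ n.choose k * (n - k).choose j := Nat.mul_le_mul_left _ h3
      _ = n.choose j * (n - j).choose k := h2.symm
      _ ≤ n.choose j * (n - j).choose ((n - j) / 2) := Nat.mul_le_mul_left _ h1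

/-- `(t+1)! ≤ (t+1)^t`. [folklore] -/
theorem factorial_succ_le_pow (t : ℕ) : (t + 1).factorial ≤ (t + 1) ^ t := by
  induction t with
  | zero => simp
  | succ t ih =>
    rw [Nat.factorial_succ, pow_succ]
    calc (t + 1 + 1) * (t + 1).factorial ≤ (t + 1 + 1) * (t + 1) ^ t := Nat.mul_le_mul_left _ ih
      _ ≤ (t + 1 + 1) * (t + 1 + 1) ^ t :=
          Nat.mul_le_mul_left _ (Nat.pow_le_pow_left (Nat.le_succ _) _)
      _ = (t + 1 + 1) ^ t * (t + 1 + 1) := mul_comm _ _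

/-- The step of `factorial_pow_mul_factorial_le`: `a! · (b+1) ≤ (⌊ab/2⌋ + 1)^a` for `a, b ≥ 2`.
[folklore] -/
theorem factorial_mul_succ_le_pow {a b : ℕ} (ha : 2 ≤ a) (hb : 2 ≤ b) :
    a.factorial * (b + 1) ≤ (a * b / 2 + 1) ^ a := by
  rcases Nat.eq_or_lt_of_le ha with h2 | ha3
  · subst h2
    rw [show 2 * b / 2 = b from by omega, Nat.factorial_two, pow_two]
    nlinarith
  · have hp1 : a ≤ a * b / 2 + 1 := by
      have : a * 2 ≤ a * b := Nat.mul_le_mul_left _ hb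
      omega
    have hp2 : b + 1 ≤ a * b / 2 + 1 := by
      have : 3 * b ≤ a * b := Nat.mul_le_mul_right _ ha3
      omega
    obtain ⟨t, rfl⟩ : ∃ t, a = t + 1 := ⟨a - 1, by omega⟩
    calc (t + 1).factorial * (b + 1) ≤ (t + 1) ^ t * (b + 1) :=
          Nat.mul_le_mul_right _ (factorial_succ_le_pow t)
      _ ≤ ((t + 1) * b / 2 + 1) ^ t * ((t + 1) * b / 2 + 1) :=
          Nat.mul_le_mul (Nat.pow_le_pow_left hp1 _) hp2
      _ = ((t + 1) * b / 2 + 1) ^ (t + 1) := (pow_succ _ _).symm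

/-- `(y+1)^d · y! ≤ (y+d)!`. [folklore] -/
theorem pow_mul_factorial_le_factorial (y d : ℕ) : (y + 1) ^ d * y.factorial ≤ (y + d).factorial := by
  induction d with
  | zero => simp
  | succ d ih =>
    rw [pow_succ, show y + (d + 1) = (y + d) + 1 from by omega, Nat.factorial_succ]
    calc (y + 1) ^ d * (y + 1) * y.factorial = (y + 1) * ((y + 1) ^ d * y.factorial) := by ring
      _ ≤ (y + d + 1) * (y + d).factorial := Nat.mul_le_mul (by omega) ih

/-- Growth of `⌊x/2⌋! ⌈x/2⌉!`:
`(⌊m/2⌋ + 1)^a · ⌊m/2⌋! · (m - ⌊m/2⌋)! ≤ ⌊(m+a)/2⌋! · (m + a - ⌊(m+a)/2⌋)!`. [folklore] -/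
theorem pow_mul_half_factorials_le (m a : ℕ) :
    (m / 2 + 1) ^ a * ((m / 2).factorial * (m - m / 2).factorial) ≤
      ((m + a) / 2).factorial * (m + a - (m + a) / 2).factorial := by
  have key : ∀ x y : ℕ, y ≤ x → (y + 1) ^ (x - y) * y.factorial ≤ x.factorial := by
    intro x y hyx
    obtain ⟨d, rfl⟩ := Nat.exists_eq_add_of_le hyx
    rw [Nat.add_sub_cancel_left]
    exact pow_mul_factorial_le_factorial y d
  have h1 := key ((m + a) / 2) (m / 2) (by omega)
  have h2 := key (m + a - (m + a) / 2) (m - m / 2) (by omega)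
  have h3 : (m / 2 + 1) ^ (m + a - (m + a) / 2 - (m - m / 2)) ≤
      (m - m / 2 + 1) ^ (m + a - (m + a) / 2 - (m - m / 2)) :=
    Nat.pow_le_pow_left (by omega) _
  have hexp : (m + a) / 2 - m / 2 + (m + a - (m + a) / 2 - (m - m / 2)) = a := by omega
  calc (m / 2 + 1) ^ a * ((m / 2).factorial * (m - m / 2).factorial)
      = ((m / 2 + 1) ^ ((m + a) / 2 - m / 2) * (m / 2).factorial) *
          ((m / 2 + 1) ^ (m + a - (m + a) / 2 - (m - m / 2)) * (m - m / 2).factorial) := by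
        conv_lhs => rw [← hexp, pow_add]
        ring
    _ ≤ ((m + a) / 2).factorial *
          ((m - m / 2 + 1) ^ (m + a - (m + a) / 2 - (m - m / 2)) * (m - m / 2).factorial) :=
        Nat.mul_le_mul h1 (Nat.mul_le_mul_right _ h3)
    _ ≤ ((m + a) / 2).factorial * (m + a - (m + a) / 2).factorial := Nat.mul_le_mul_left _ h2

/-- **The order of `S_a wr S_b` against `2 |S_{⌊m/2⌋} × S_{⌈m/2⌉}|`**: for `a, b ≥ 2`,
`(a!)^b · b! ≤ 2 · ⌊ab/2⌋! · ⌈ab/2⌉!` (induction on `b`; equality at `b = 2`). [folklore] -/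
theorem factorial_pow_mul_factorial_le {a b : ℕ} (ha : 2 ≤ a) (hb : 2 ≤ b) :
    a.factorial ^ b * b.factorial ≤ 2 * ((a * b / 2).factorial * (a * b - a * b / 2).factorial) := by
  induction b, hb using Nat.le_induction with
  | base =>
    rw [show a * 2 / 2 = a from by omega, show a * 2 - a = a from by omega, Nat.factorial_two, pow_two]
    ring_nf
    exact le_rfl
  | succ b hb ih =>
    have hstep := factorial_mul_succ_le_pow ha hb
    have hgrow := pow_mul_half_factorials_le (a * b) a
    have hm : a * (b + 1) = a * b + a := by ring
    rw [hm]
    calc a.factorial ^ (b + 1) * (b + 1).factorial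
        = (a.factorial ^ b * b.factorial) * (a.factorial * (b + 1)) := by
          rw [pow_succ, Nat.factorial_succ]; ring
      _ ≤ (2 * ((a * b / 2).factorial * (a * b - a * b / 2).factorial)) * ((a * b / 2 + 1) ^ a) :=
          Nat.mul_le_mul ih hstep
      _ = 2 * ((a * b / 2 + 1) ^ a * ((a * b / 2).factorial * (a * b - a * b / 2).factorial)) := by ring
      _ ≤ 2 * (((a * b + a) / 2).factorial * (a * b + a - (a * b + a) / 2).factorial) :=
          Nat.mul_le_mul_left _ hgrow

/-- `C(x, ⌊x/2⌋) · (⌊x/2⌋! · (x - ⌊x/2⌋)!) = x!`. [folklore] -/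
theorem choose_half_mul_factorials (x : ℕ) :
    x.choose (x / 2) * ((x / 2).factorial * (x - x / 2).factorial) = x.factorial := by
  rw [← mul_assoc]; exact Nat.choose_mul_factorial_mul_factorial (Nat.div_le_self _ _)

/-- `C(N, K) ≤ N · C(N, K - 1)` for `K ≥ 1`. [folklore] -/
theorem choose_le_mul_choose_pred {N K : ℕ} (hK : 1 ≤ K) : N.choose K ≤ N * N.choose (K - 1) := by
  obtain ⟨K, rfl⟩ : ∃ K', K = K' + 1 := ⟨K - 1, by omega⟩
  rw [Nat.add_sub_cancel]
  have := Nat.choose_succ_right_eq N K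
  -- `C(N, K+1) (K+1) = C(N, K) (N - K)`
  nlinarith [Nat.zero_le (N.choose K), Nat.sub_le N K]

/-- A five-term over-count of a Vandermonde sum with `C(4, ·)`. [folklore] -/
theorem sum_mul_choose_four_le (f : ℕ → ℕ) (K : ℕ) :
    ∑ i ∈ Finset.range (K + 1), f i * Nat.choose 4 (K - i) ≤
      f K + 4 * f (K - 1) + 6 * f (K - 2) + 4 * f (K - 3) + f (K - 4) := by
  have c2 : Nat.choose 4 2 = 6 := by decide
  have c3 : Nat.choose 4 3 = 4 := by decide
  rcases K with _ | _ | _ | _ | K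
  · simp
  · simp [Finset.sum_range_succ]; omega
  · simp [Finset.sum_range_succ, c2]; omega
  · simp [Finset.sum_range_succ, c2]; omega
  · -- `K + 4`: the first `K` terms vanish
    rw [Finset.sum_range_succ, Finset.sum_range_succ, Finset.sum_range_succ, Finset.sum_range_succ,
      Finset.sum_range_succ]
    have h0 : ∑ i ∈ Finset.range K, f i * Nat.choose 4 (K + 4 - i) = 0 :=
      Finset.sum_eq_zero fun i hi => by
        rw [Nat.choose_eq_zero_of_lt (by have := Finset.mem_range.1 hi; omega), mul_zero]
    rw [h0]
    simp only [show K + 4 - K = 4 from by omega, show K + 4 - (K + 1) = 3 from by omega,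
      show K + 4 - (K + 2) = 2 from by omega, show K + 4 - (K + 3) = 1 from by omega,
      Nat.sub_self, c2, c3, Nat.choose_self, Nat.choose_zero_right,
      Nat.choose_one_right, show K + 4 - 1 = K + 3 from by omega, show K + 4 - 2 = K + 2 from by omega,
      show K + 4 - 3 = K + 1 from by omega, show K + 4 - 4 = K from by omega,
      show K + 1 + 1 + 1 + 1 = K + 4 from rfl, show K + 1 + 1 + 1 = K + 3 from rfl,
      show K + 1 + 1 = K + 2 from rfl]
    omega

/-- **Binomials against half factorials**: for `N ≥ 9` and `4K ≤ N + 3`, `C(N, K) ≤ ⌈N/2⌉!`.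
Proof: four base cases `N = 9, …, 12`, then `N → N + 4` through Vandermonde with `C(4, ·)` and
`(⌈N/2⌉ + 1)(⌈N/2⌉ + 2) ≥ N + 15`. [folklore] -/
theorem choose_le_factorial_half {N K : ℕ} (hN : 9 ≤ N) (hK : 4 * K ≤ N + 3) :
    N.choose K ≤ (N - N / 2).factorial := by
  induction N using Nat.strong_induction_on generalizing K with
  | _ N ih =>
    by_cases hsmall : N ≤ 12
    · have hK3 : K ≤ 3 := by omega
      interval_cases N <;> interval_cases K <;> decide
    · push Not at hsmall
      obtain ⟨M, rfl⟩ : ∃ M, N = M + 4 := ⟨N - 4, by omega⟩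
      have hM : 9 ≤ M := by omega
      set F := (M - M / 2).factorial with hFdef
      have hIH : ∀ K', 4 * K' ≤ M + 3 → M.choose K' ≤ F := fun K' hK' => ih M (by omega) hM hK'
      -- Vandermonde and the five-term over-count
      have hV : (M + 4).choose K ≤ M.choose K + 4 * M.choose (K - 1) + 6 * M.choose (K - 2) +
          4 * M.choose (K - 3) + M.choose (K - 4) := by
        rw [Nat.add_choose_eq M 4 K, Finset.Nat.sum_antidiagonal_eq_sum_range_succ_mk]
        exact sum_mul_choose_four_le (fun i => M.choose i) K
      have hF : ∀ i, 1 ≤ i → M.choose (K - i) ≤ F := fun i hi => hIH _ (by omega)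
      have h0 : M.choose K ≤ M * F := by
        rcases Nat.eq_zero_or_pos K with hK0 | hKpos
        · rw [hK0, Nat.choose_zero_right]
          have := Nat.factorial_pos (M - M / 2)
          calc 1 ≤ F := this
            _ ≤ M * F := Nat.le_mul_of_pos_left _ (by omega)
        · exact (choose_le_mul_choose_pred hKpos).trans (Nat.mul_le_mul_left _ (hF 1 le_rfl))
      have hsum : (M + 4).choose K ≤ (M + 15) * F := by
        have e1 := hF 1 le_rfl
        have e2 := hF 2 (by norm_num)
        have e3 := hF 3 (by norm_num)
        have e4 := hF 4 (by norm_num)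
        calc (M + 4).choose K ≤ M.choose K + 4 * M.choose (K - 1) + 6 * M.choose (K - 2) +
              4 * M.choose (K - 3) + M.choose (K - 4) := hV
          _ ≤ M * F + 4 * F + 6 * F + 4 * F + F :=
              Nat.add_le_add (Nat.add_le_add (Nat.add_le_add (Nat.add_le_add h0
                (Nat.mul_le_mul_left _ e1)) (Nat.mul_le_mul_left _ e2)) (Nat.mul_le_mul_left _ e3)) e4
          _ = (M + 15) * F := by ring
      have hgrow : (M + 15) * F ≤ (M + 4 - (M + 4) / 2).factorial := by
        have e : M + 4 - (M + 4) / 2 = (M - M / 2) + 1 + 1 := by omega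
        rw [e, Nat.factorial_succ, Nat.factorial_succ, hFdef]
        have hc5 : 5 ≤ M - M / 2 := by omega
        have hM2c : M ≤ 2 * (M - M / 2) := by omega
        have hc : M + 15 ≤ (M - M / 2 + 1 + 1) * (M - M / 2 + 1) := by nlinarith
        calc (M + 15) * (M - M / 2).factorial
            ≤ ((M - M / 2 + 1 + 1) * (M - M / 2 + 1)) * (M - M / 2).factorial := Nat.mul_le_mul_right _ hc
          _ = (M - M / 2 + 1 + 1) * ((M - M / 2 + 1) * (M - M / 2).factorial) := by ring
      exact hsum.trans hgrow

/-- **The primitive estimate**: `C(n, k) ≤ C(n, j) · ⌈(n-j)/2⌉!` for `j < k`, `4k ≤ n`, `9 ≤ n`.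
[folklore] -/
theorem choose_le_choose_mul_factorial_half {n k j : ℕ} (hn : 9 ≤ n) (h : 4 * k ≤ n) (hj : j < k) :
    n.choose k ≤ n.choose j * (n - j - (n - j) / 2).factorial := by
  rcases Nat.eq_zero_or_pos j with rfl | hjpos
  · simpa using choose_le_factorial_half hn (by omega)
  · -- `C(n,k) ≤ C(n,j) C(n-j, k-j)` and `C(n-j, k-j) ≤ ⌈(n-j)/2⌉!`
    have h1 : n.choose k ≤ n.choose j * (n - j).choose (k - j) := by
      have e : n.choose k * k.choose j = n.choose j * (n - j).choose (k - j) :=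
        Nat.choose_mul (n := n) (k := k) (s := j) hj.le
      calc n.choose k ≤ n.choose k * k.choose j :=
            Nat.le_mul_of_pos_right _ (Nat.choose_pos hj.le)
        _ = n.choose j * (n - j).choose (k - j) := e
    refine h1.trans (Nat.mul_le_mul_left _ ?_)
    set N := n - j with hN
    by_cases hN9 : 9 ≤ N
    · exact choose_le_factorial_half hN9 (by omega)
    · -- then `N = 8` and `k - j ≤ 1`
      have hN8 : N = 8 := by omega
      have hK : k - j ≤ 1 := by omega
      rw [hN8]
      set K := k - j with hKdef
      interval_cases K <;> decide

end Arithmetic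

/-! ### Restriction of a permutation group to an invariant subtype -/

section Restrict

variable {α : Type*}

/-- The restriction homomorphism of `G ≤ Sym(α)` to a `G`-invariant subtype. [folklore] -/
def restr (G : Subgroup (Perm α)) (p : α → Prop) (hp : ∀ g ∈ G, ∀ x, p (g x) ↔ p x) :
    G →* Perm {x // p x} where
  toFun g := (g : Perm α).subtypePerm (hp g g.2)
  map_one' := by ext x; simp
  map_mul' g h := by ext x; simp

/-- The restriction acts by the permutation. [folklore] -/
@[simp] theorem restr_apply_coe (G : Subgroup (Perm α)) (p : α → Prop) (hp : ∀ g ∈ G, ∀ x, p (g x) ↔ p x)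
    (g : G) (x : {x // p x}) : ((restr G p hp g) x : α) = (g : Perm α) x := rfl

end Restrict

/-! ### The theorem -/

section SmallIndex

open scoped Classical Pointwise

variable {α : Type*} [Fintype α] [DecidableEq α]

/-- **Step 1.** A `G`-invariant subset has fewer than `k` or more than `n - k` points when
`[Sym : G] < C(n, k)`. [cite: DixonMortimer1996, Thm 5.2B (proof)] -/
theorem card_lt_or_lt_of_invariant (G : Subgroup (Perm α)) {k : ℕ}
    (hidx : G.index < (Fintype.card α).choose k) (D : Finset α) (hD : ∀ g ∈ G, ∀ x ∈ D, g x ∈ D) :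
    D.card < k ∨ Fintype.card α - k < D.card := by
  by_contra h
  push Not at h
  have h1 := choose_le_index_of_mapsTo D G hD
  have h2 := choose_le_choose_of_le_of_le_sub h.1 h.2 (Finset.card_le_univ D)
  omega

omit [DecidableEq α] in
/-- The orbit of a point, as a finset, is `G`-invariant and contains the point. [folklore] -/
theorem orbit_toFinset_invariant (G : Subgroup (Perm α)) (x : α) :
    ∀ g ∈ G, ∀ y ∈ (orbit G x).toFinset, g y ∈ (orbit G x).toFinset := by
  intro g hg y hy
  rw [Set.mem_toFinset] at hy ⊢
  obtain ⟨h, rfl⟩ := mem_orbit_iff.1 hy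
  exact mem_orbit_iff.2 ⟨⟨g, hg⟩ * h, rfl⟩

/-- **Step 2.** The union of the orbits of size `< k` has fewer than `k` points (`3k ≤ n`).
[cite: DixonMortimer1996, Thm 5.2B (proof)] -/
theorem card_filter_small_lt (G : Subgroup (Perm α)) {k : ℕ}
    (h3k : 3 * k ≤ Fintype.card α) (hidx : G.index < (Fintype.card α).choose k) :
    (Finset.univ.filter fun x : α => (orbit G x).toFinset.card < k).card < k := by
  set X := Finset.univ.filter fun x : α => (orbit G x).toFinset.card < k with hX
  -- every invariant subset of `X` is small, by strong induction on its size
  suffices hmain : ∀ (c : ℕ) (D : Finset α), D.card = c → D ⊆ X → (∀ g ∈ G, ∀ x ∈ D, g x ∈ D) → D.card < k by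
    refine hmain _ X rfl subset_rfl fun g hg x hx => ?_
    simp only [hX, Finset.mem_filter, Finset.mem_univ, true_and] at hx ⊢
    have : orbit G (g x) = orbit G x := by
      rw [show g x = (⟨g, hg⟩ : G) • x from rfl, orbit_smul]
    rwa [this]
  intro c
  induction c using Nat.strong_induction_on with
  | _ c ih =>
    intro D hDc hDX hD
    rcases card_lt_or_lt_of_invariant G hidx D hD with h | h
    · exact h
    · exfalso
      -- peel off the orbit of a point of `D`
      have hDne : D.Nonempty := by
        rw [← Finset.card_pos]; omega
      obtain ⟨x, hx⟩ := hDne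
      set O := (orbit G x).toFinset with hO
      have hOD : O ⊆ D := by
        intro y hy
        rw [hO, Set.mem_toFinset] at hy
        obtain ⟨g, rfl⟩ := hy
        exact hD g g.2 x hx
      have hOk : O.card < k := by
        have := hDX hx
        simp only [hX, Finset.mem_filter, Finset.mem_univ, true_and] at this
        exact this
      have hxO : x ∈ O := by rw [hO, Set.mem_toFinset]; exact mem_orbit_self x
      set D' := D \ O with hD'
      have hD'inv : ∀ g ∈ G, ∀ y ∈ D', g y ∈ D' := by
        intro g hg y hy
        rw [hD', Finset.mem_sdiff] at hy ⊢
        refine ⟨hD g hg y hy.1, fun hgy => hy.2 ?_⟩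
        have := orbit_toFinset_invariant G x g⁻¹ (G.inv_mem hg) (g y) hgy
        rw [show g⁻¹ (g y) = y from by simp] at this
        exact this
      have hD'card : D'.card = D.card - O.card := by rw [hD', Finset.card_sdiff_of_subset hOD]
      have hlt : D'.card < c := by
        have : 0 < O.card := Finset.card_pos.2 ⟨x, hxO⟩
        omega
      have := ih _ hlt D' rfl (Finset.sdiff_subset.trans hDX) hD'inv
      omega

/-- **Dixon–Mortimer, *Permutation Groups*, Theorem 5.2B** (as printed in Dawar–Wilsenach, *Symmetric circuits for rank logic* (2021), §4): let `n := |α| > 8` and `1 ≤ k ≤ n/4`; if `G ≤ Sym(α)` has index `[Sym(α) : G] < C(n, k)`,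
then there is `X ⊆ α` with `|X| < k` such that every even permutation of `α` fixing `X`
pointwise lies in `G` (`Stab_{Alt(α)}(X) ≤ G`). [cite: DixonMortimer1996, Thm 5.2B; DawarWilsenach2021, §4 Thm (dixonmort)] -/
theorem alternating_fixing_le_of_index_lt_choose (G : Subgroup (Perm α)) (k : ℕ)
    (hn : 8 < Fintype.card α) (hk : 1 ≤ k) (h4k : 4 * k ≤ Fintype.card α)
    (hidx : G.index < (Fintype.card α).choose k) :
    ∃ X : Finset α, X.card < k ∧
      ∀ ρ : Perm α, (∀ x ∈ X, ρ x = x) → Equiv.Perm.sign ρ = 1 → ρ ∈ G := by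
  set n := Fintype.card α with hn_def
  set X := Finset.univ.filter fun x : α => (orbit G x).toFinset.card < k with hX
  have hXk : X.card < k := card_filter_small_lt G (by omega) hidx
  -- invariance of `X` and of its complement
  have hXmem : ∀ x, x ∈ X ↔ (orbit G x).toFinset.card < k := fun x => by simp [hX]
  have hXinv : ∀ g ∈ G, ∀ x ∈ X, g x ∈ X := by
    intro g hg x hx
    rw [hXmem] at hx ⊢
    have : orbit G (g x) = orbit G x := by
      rw [show g x = (⟨g, hg⟩ : G) • x from rfl, orbit_smul]
    rwa [this]
  have hp : ∀ g ∈ G, ∀ x, g x ∉ X ↔ x ∉ X := by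
    intro g hg x
    constructor
    · intro h hx; exact h (hXinv g hg x hx)
    · intro h; exact mapsTo_compl_of_mapsTo X (hXinv g hg) x h
  refine ⟨X, hXk, ?_⟩
  -- the restriction to `Ω' = α ∖ X`
  set res := restr G (fun x => x ∉ X) hp with hres
  set H : Subgroup (Perm {x // x ∉ X}) := res.range with hH
  -- sizes
  set j := X.card with hj
  have hm : Fintype.card {x // x ∉ X} = n - j := by
    rw [Fintype.card_subtype_compl, Fintype.card_coe]
  have hm7 : 7 ≤ n - j := by omega
  -- `|G| = |ker res| · |H|` and `|ker res| ≤ j!`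
  have hker : Nat.card res.ker ≤ j.factorial := by
    -- the kernel embeds in `Sym(X)`
    have hpX : ∀ g : res.ker, ∀ x, (g : Perm α) x ∈ X ↔ x ∈ X := by
      intro g x
      constructor
      · intro h
        by_contra hx
        exact ((hp _ g.1.2 x).2 hx) h
      · exact hXinv _ g.1.2 x
    let Φ : res.ker → Perm {x // x ∈ X} := fun g => ((g : G) : Perm α).subtypePerm (hpX g)
    have hΦ : Function.Injective Φ := by
      intro g g' hgg'
      apply Subtype.ext; apply Subtype.ext
      ext x
      by_cases hx : x ∈ X
      · have := congrArg (fun f : Perm {x // x ∈ X} => ((f ⟨x, hx⟩ : {x // x ∈ X}) : α)) hgg'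
        simpa [Φ] using this
      · have h1 : res (g : G) = 1 := g.2
        have h2 : res (g' : G) = 1 := g'.2
        have e1 := congrArg (fun f : Perm {x // x ∉ X} => ((f ⟨x, hx⟩ : {x // x ∉ X}) : α)) h1
        have e2 := congrArg (fun f : Perm {x // x ∉ X} => ((f ⟨x, hx⟩ : {x // x ∉ X}) : α)) h2
        simp only [hres, restr_apply_coe, Perm.coe_one, id_eq] at e1 e2
        rw [e1]; exact e2.symm
    calc Nat.card res.ker ≤ Nat.card (Perm {x // x ∈ X}) := Nat.card_le_card_of_injective Φ hΦ
      _ = j.factorial := by rw [Nat.card_perm, Nat.card_eq_fintype_card, Fintype.card_coe]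
  have hGcard : Nat.card G = Nat.card res.ker * Nat.card H := by
    rw [← res.ker.card_mul_index, Subgroup.index_ker]
  have hGle : Nat.card G ≤ j.factorial * Nat.card H := by
    rw [hGcard]; exact Nat.mul_le_mul_right _ hker
  -- `n! = [Sym : G] · |G| < C(n, k) · |G|`
  have hfac : G.index * Nat.card G = n.factorial := by
    rw [Subgroup.index_mul_card, Nat.card_perm, Nat.card_eq_fintype_card]
  have hGpos : 0 < Nat.card G := Nat.card_pos
  have hlt : n.factorial < n.choose k * Nat.card G := by
    rw [← hfac]; exact Nat.mul_lt_mul_of_pos_right hidx hGpos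
  -- transitivity of `H` on `Ω'`
  have horb_big : ∀ x, x ∉ X → ∀ y, y ∉ X → y ∈ orbit G x := by
    intro x hx y hy
    by_contra hyx
    -- two disjoint big orbits
    have hOx := card_lt_or_lt_of_invariant G hidx _ (orbit_toFinset_invariant G x)
    have hOy := card_lt_or_lt_of_invariant G hidx _ (orbit_toFinset_invariant G y)
    rw [hXmem] at hx hy
    have hx' : n - k < (orbit G x).toFinset.card := hOx.resolve_left hx
    have hy' : n - k < (orbit G y).toFinset.card := hOy.resolve_left hy
    have hdisj : Disjoint (orbit G x).toFinset (orbit G y).toFinset := by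
      rw [Finset.disjoint_left]
      intro z hzx hzy
      rw [Set.mem_toFinset] at hzx hzy
      apply hyx
      rw [mem_orbit_iff] at hzx hzy ⊢
      obtain ⟨g, rfl⟩ := hzx
      obtain ⟨h, hh⟩ := hzy
      refine ⟨h⁻¹ * g, ?_⟩
      rw [mul_smul, ← hh, inv_smul_smul]
    have := Finset.card_le_univ ((orbit G x).toFinset ∪ (orbit G y).toFinset)
    rw [Finset.card_union_of_disjoint hdisj] at this
    omega
  haveI hHtrans : IsPretransitive H {x // x ∉ X} := by
    refine ⟨fun x y => ?_⟩
    obtain ⟨g, hg⟩ := mem_orbit_iff.1 (horb_big x.1 x.2 y.1 y.2)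
    refine ⟨⟨res g, ⟨g, rfl⟩⟩, Subtype.ext ?_⟩
    show ((res g) x : α) = y
    rw [hres, restr_apply_coe]
    exact hg
  have hcardΩ : 5 ≤ Nat.card {x // x ∉ X} := by
    rw [Nat.card_eq_fintype_card, hm]; omega
  -- the factorial identity `n! = C(n, j) j! (n-j)!`
  have hnj : n.choose j * j.factorial * (n - j).factorial = n.factorial :=
    Nat.choose_mul_factorial_mul_factorial (by omega)
  -- case analysis on `H`
  by_cases hprim : IsPreprimitive H {x // x ∉ X}
  · by_cases hAlt : alternatingGroup {x // x ∉ X} ≤ H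
    · ---------------------------------------------------------------- step 5
      -- `K` = elements of `G` fixing `X` pointwise
      have hpX : ∀ g ∈ G, ∀ x, g x ∈ X ↔ x ∈ X := by
        intro g hg x
        constructor
        · intro h; by_contra hx; exact ((hp g hg x).2 hx) h
        · exact hXinv g hg x
      set resX := restr G (fun x => x ∈ X) hpX with hresX
      set K : Subgroup G := resX.ker with hK
      have hKmem : ∀ g : G, g ∈ K ↔ ∀ x ∈ X, (g : Perm α) x = x := by
        intro g
        rw [hK, MonoidHom.mem_ker]
        constructor
        · intro h x hx
          have := congrArg (fun f : Perm {x // x ∈ X} => ((f ⟨x, hx⟩ : {x // x ∈ X}) : α)) h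
          simpa [hresX] using this
        · intro h
          ext ⟨x, hx⟩
          simp [hresX, h x hx]
      -- `[G : K] ≤ j!`, so `|K| ≥ 3`
      have hKidx : K.index ≤ j.factorial := by
        rw [hK, Subgroup.index_ker]
        calc Nat.card (Set.range resX) ≤ Nat.card (Perm {x // x ∈ X}) :=
              Nat.card_le_card_of_injective _ Subtype.val_injective
          _ = j.factorial := by rw [Nat.card_perm, Nat.card_eq_fintype_card, Fintype.card_coe]
      have hK3 : 3 ≤ Nat.card K := by
        by_contra hK2
        push Not at hK2
        have h1 : Nat.card G ≤ 2 * j.factorial := by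
          rw [← K.card_mul_index]
          exact Nat.mul_le_mul (by omega) hKidx
        -- `n! < C(n,k) · 2 · j! ≤ C(n,k) · 2 · (k-1)!`, but `n! = C(n,k) k! (n-k)! ≥ C(n,k) (k-1)! · k (n-k)!`
        have h2 : n.factorial < n.choose k * (2 * j.factorial) :=
          hlt.trans_le (Nat.mul_le_mul_left _ h1)
        have h3 : j.factorial ≤ (k - 1).factorial := Nat.factorial_le (by omega)
        have h4 : n.choose k * k.factorial * (n - k).factorial = n.factorial :=
          Nat.choose_mul_factorial_mul_factorial (by omega)
        have h5 : k.factorial = k * (k - 1).factorial := by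
          obtain ⟨t, rfl⟩ : ∃ t, k = t + 1 := ⟨k - 1, by omega⟩
          simp [Nat.factorial_succ]
        have h6 : 2 ≤ (n - k).factorial := by
          calc 2 = Nat.factorial 2 := rfl
            _ ≤ (n - k).factorial := Nat.factorial_le (by omega)
        have h7 : 2 ≤ k * (n - k).factorial := le_trans h6 (Nat.le_mul_of_pos_left _ hk)
        have : n.choose k * (2 * (k - 1).factorial) ≤ n.factorial := by
          calc n.choose k * (2 * (k - 1).factorial) = n.choose k * (k - 1).factorial * 2 := by ring
            _ ≤ n.choose k * (k - 1).factorial * (k * (n - k).factorial) := Nat.mul_le_mul_left _ h7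
            _ = n.choose k * (k * (k - 1).factorial) * (n - k).factorial := by ring
            _ = n.factorial := by rw [← h5, h4]
        exact lt_irrefl _ (h2.trans_le (le_trans (Nat.mul_le_mul_left _ (Nat.mul_le_mul_left _ h3)) this))
      -- `L = res(K)`
      set L := K.map res with hL
      -- `res` is injective on `K`
      have hresK : ∀ g ∈ K, ∀ g' ∈ K, res g = res g' → g = g' := by
        intro g hg g' hg' hgg'
        apply Subtype.ext
        ext x
        by_cases hx : x ∈ X
        · rw [(hKmem g).1 hg x hx, (hKmem g').1 hg' x hx]
        · have := congrArg (fun f : Perm {x // x ∉ X} => ((f ⟨x, hx⟩ : {x // x ∉ X}) : α)) hgg'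
          simpa [hres] using this
      have hLcard : Nat.card L = Nat.card K := by
        rw [hL]
        refine (Nat.card_congr ?_).symm
        refine Equiv.ofBijective (fun g => ⟨res g.1, ⟨g.1, g.2, rfl⟩⟩) ⟨fun g g' h => ?_, fun l => ?_⟩
        · exact Subtype.ext (hresK _ g.2 _ g'.2 (congrArg Subtype.val h))
        · obtain ⟨l, g, hg, rfl⟩ := l
          exact ⟨⟨g, hg⟩, rfl⟩
      -- `L` is normalised by `H`
      have hLnorm : ∀ h ∈ H, ∀ l ∈ L, h * l * h⁻¹ ∈ L := by
        rintro _ ⟨g, rfl⟩ _ ⟨κ, hκ, rfl⟩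
        refine ⟨g * κ * g⁻¹, ?_, by simp [map_mul, map_inv]⟩
        rw [hK] at hκ ⊢
        exact (MonoidHom.normal_ker resX).conj_mem κ hκ g
      -- the normal subgroup `N = L ∩ Alt` of `Alt(Ω')`
      set A := alternatingGroup {x // x ∉ X} with hA
      set N : Subgroup A := L.comap A.subtype with hN
      haveI hNnormal : N.Normal := by
        refine ⟨fun a ha b => ?_⟩
        rw [hN, Subgroup.mem_comap] at ha ⊢
        simp only [Subgroup.coe_subtype, Subgroup.coe_mul, InvMemClass.coe_inv]
        exact hLnorm _ (hAlt b.2) _ ha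
      have hAL : A ≤ L := by
        rcases alternatingGroup.normal_subgroup_eq_bot_or_eq_top hcardΩ (N := N) with hbot | htop
        · -- `L ∩ Alt = 1` forces `|L| ≤ 2`
          exfalso
          have hinj : Function.Injective (fun l : L => Equiv.Perm.sign (l : Perm {x // x ∉ X})) := by
            intro l l' hll'
            simp only at hll'
            have hmem : (l : Perm {x // x ∉ X}) * (l' : Perm _)⁻¹ ∈ A := by
              rw [hA, Equiv.Perm.mem_alternatingGroup, map_mul, map_inv, hll', mul_inv_cancel]
            have hN1 : (⟨_, hmem⟩ : A) ∈ N := by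
              rw [hN, Subgroup.mem_comap, Subgroup.coe_subtype]
              exact L.mul_mem l.2 (L.inv_mem l'.2)
            rw [hbot, Subgroup.mem_bot] at hN1
            have : (l : Perm {x // x ∉ X}) * (l' : Perm _)⁻¹ = 1 := congrArg Subtype.val hN1
            exact Subtype.ext (mul_inv_eq_one.1 this)
          have h2 : Nat.card L ≤ 2 := by
            calc Nat.card L ≤ Nat.card ℤˣ := Nat.card_le_card_of_injective _ hinj
              _ = 2 := by rw [Nat.card_eq_fintype_card, Fintype.card_units_int]
          rw [hLcard] at h2
          omega
        · intro a ha
          have : (⟨a, ha⟩ : A) ∈ N := by rw [htop]; exact Subgroup.mem_top _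
          rw [hN, Subgroup.mem_comap] at this
          exact this
      -- conclusion
      intro ρ hρX hρsign
      have hρp : ∀ x, ρ x ∉ X ↔ x ∉ X := by
        intro x
        by_cases hx : x ∈ X
        · rw [hρX x hx]
        · constructor
          · intro _; exact hx
          · intro _ hρx
            -- `ρ` maps `X` onto `X`, so `ρ x ∈ X` forces `x ∈ X`
            have : ρ.symm (ρ x) ∈ X := by
              have hsurj : ∀ y ∈ X, ∃ z ∈ X, ρ z = y := fun y hy => ⟨y, hy, hρX y hy⟩
              obtain ⟨z, hz, hzx⟩ := hsurj _ hρx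
              rw [← hzx, Equiv.symm_apply_apply]; exact hz
            rw [Equiv.symm_apply_apply] at this
            exact hx this
      set ρ' : Perm {x // x ∉ X} := ρ.subtypePerm hρp with hρ'
      have hρ'A : ρ' ∈ A := by
        rw [hA, Equiv.Perm.mem_alternatingGroup, hρ']
        have h2 : ∀ x, ρ x ≠ x → x ∉ X := fun x hx hxX => hx (hρX x hxX)
        have := Equiv.Perm.sign_subtypePerm ρ hρp h2
        rw [hρsign] at this
        convert this using 2
      obtain ⟨κ, hκK, hκ⟩ := hAL hρ'A
      have hρκ : ((κ : G) : Perm α) = ρ := by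
        ext x
        by_cases hx : x ∈ X
        · rw [(hKmem κ).1 hκK x hx, hρX x hx]
        · have := congrArg (fun f : Perm {x // x ∉ X} => ((f ⟨x, hx⟩ : {x // x ∉ X}) : α)) hκ
          simpa [hres, hρ'] using this
      rw [← hρκ]; exact κ.2
    · ---------------------------------------------------------------- primitive, not ⊇ Alt: Bochert
      exfalso
      have hB := Bochert.card_le_descFactorial H hprim hAlt
      rw [hm] at hB
      -- `n! < C(n,k) j! |H| ≤ C(n,k) j! (n-j).descFactorial ((n-j)/2) ≤ C(n,j) j! ⌈(n-j)/2⌉! (n-j).descFactorial … = n!`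
      have h1 : n.factorial < n.choose k * (j.factorial * (n - j).descFactorial ((n - j) / 2)) :=
        hlt.trans_le (Nat.mul_le_mul_left _ (hGle.trans (Nat.mul_le_mul_left _ hB)))
      have h2 := choose_le_choose_mul_factorial_half (n := n) (k := k) (j := j) (by omega) h4k hXk
      have h3 : (n - j - (n - j) / 2).factorial * (n - j).descFactorial ((n - j) / 2) = (n - j).factorial :=
        Nat.factorial_mul_descFactorial (Nat.div_le_self _ _)
      have : n.choose k * (j.factorial * (n - j).descFactorial ((n - j) / 2)) ≤ n.factorial := by
        calc n.choose k * (j.factorial * (n - j).descFactorial ((n - j) / 2))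
            ≤ (n.choose j * (n - j - (n - j) / 2).factorial) * (j.factorial * (n - j).descFactorial ((n - j) / 2)) :=
              Nat.mul_le_mul_right _ h2
          _ = n.choose j * j.factorial * ((n - j - (n - j) / 2).factorial * (n - j).descFactorial ((n - j) / 2)) := by ring
          _ = n.factorial := by rw [h3, hnj]
      exact lt_irrefl _ (h1.trans_le this)
  · ------------------------------------------------------------------ imprimitive: blocks
    exfalso
    have hblk : ∃ B : Set {x // x ∉ X}, IsBlock H B ∧ ¬ IsTrivialBlock B := by
      by_contra hcon
      push Not at hcon
      exact hprim { isTrivialBlock_of_isBlock := fun hB => hcon _ hB }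
    obtain ⟨B, hBblock, hBnt⟩ := hblk
    rw [IsTrivialBlock, not_or] at hBnt
    set Bf := B.toFinset with hBf
    have hBfB : (Bf : Set {x // x ∉ X}) = B := Set.coe_toFinset B
    have hBne : Bf.Nonempty := by
      rw [← Finset.coe_nonempty, hBfB, Set.nonempty_iff_ne_empty]
      rintro rfl; exact hBnt.1 Set.subsingleton_empty
    obtain ⟨hab, hHle⟩ := card_le_of_isBlock H Bf hBne (hBfB ▸ hBblock)
    set a := Bf.card with ha
    generalize hb : Nat.card (orbit H Bf) = b at hab hHle
    rw [hm] at hab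
    have ha2 : 2 ≤ a := by
      rw [ha, hBf]
      have : ¬ B.Subsingleton := hBnt.1
      rw [Set.not_subsingleton_iff, ← Set.one_lt_ncard_iff_nontrivial] at this
      rw [← Set.ncard_eq_toFinset_card']
      exact this
    have ham : a < n - j := by
      have hne : Bf ≠ Finset.univ := by
        intro h
        apply hBnt.2
        rw [← hBfB, h, Finset.coe_univ]
      have := Finset.card_lt_card (Finset.ssubset_univ_iff.2 hne)
      rwa [Finset.card_univ, hm] at this
    have hb2 : 2 ≤ b := by
      by_contra hb1
      push Not at hb1
      interval_cases b <;> omega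
    have hW := factorial_pow_mul_factorial_le ha2 hb2
    rw [hab] at hW
    -- `n! < C(n,k) j! |H| ≤ C(n,k) j! 2 ⌊m/2⌋! ⌈m/2⌉! ≤ C(n,j) C(m,⌊m/2⌋) j! ⌊m/2⌋! ⌈m/2⌉! = n!`
    have h1 : n.factorial < n.choose k * (j.factorial * (2 * (((n - j) / 2).factorial * (n - j - (n - j) / 2).factorial))) :=
      hlt.trans_le (Nat.mul_le_mul_left _ (hGle.trans (Nat.mul_le_mul_left _ (hHle.trans hW))))
    have h2 := two_mul_choose_le (n := n) (k := k) (j := j) h4k (by omega) hXk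
    have h3 := choose_half_mul_factorials (n - j)
    have : n.choose k * (j.factorial * (2 * (((n - j) / 2).factorial * (n - j - (n - j) / 2).factorial))) ≤ n.factorial := by
      calc n.choose k * (j.factorial * (2 * (((n - j) / 2).factorial * (n - j - (n - j) / 2).factorial)))
          = (2 * n.choose k) * (j.factorial * (((n - j) / 2).factorial * (n - j - (n - j) / 2).factorial)) := by ring
        _ ≤ (n.choose j * (n - j).choose ((n - j) / 2)) * (j.factorial * (((n - j) / 2).factorial * (n - j - (n - j) / 2).factorial)) :=
            Nat.mul_le_mul_right _ h2
        _ = n.choose j * j.factorial * ((n - j).choose ((n - j) / 2) * (((n - j) / 2).factorial * (n - j - (n - j) / 2).factorial)) := by ring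
        _ = n.factorial := by rw [h3, hnj]
    exact lt_irrefl _ (h1.trans_le this)

end SmallIndex

end Literature.GroupTheory.PermutationGroups
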